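import Mathlib
import Literature.RingTheory.CohomologyAnnihilator.BaseChangeRetract
import Literature.RingTheory.CohomologyAnnihilator.StrongGenerator
import Literature.RingTheory.CohomologyAnnihilator.TowerSyzygy
import Literature.RingTheory.CohomologyAnnihilator.TowerRestrict
import Literature.RingTheory.CohomologyAnnihilator.StableAnnihilation
import Literature.RingTheory.CohomologyAnnihilator.NoetherDifferentAnnihilator
import Literature.RingTheory.CohomologyAnnihilator.Localization
import HarnessLib

/-!
# [OURS · LADDER-RESOLUTION L1 · slot W5.1 · kill test K5.1b continuation] Pull-back of cohomology
# annihilators along a split finite projective extension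

Supports the host item `Globalisation` stmt-ResolutionOfSingularities-16486 (route `HomologicalConductor`)
through OUR statement `CaLocalAtClosedPoints` (`Theorems/HomologicalConductorGlobalisationK51ClosedPointLocality`);
nothing here is a statement of the manuscript under adjudication in cell res-hironaka and nothing is
attributed to its author. Report: cell res-hironaka, `L/res-L1-k51/KILL-TEST-K5.1-k51.md` §10.1 (S3).

**The lemma (OURS; folklore-level, assembled from [IyengarTakahashi2014, §2]).** Let `A → B` be
commutative noetherian rings with `B` finitely generated and projective as an `A`-module and such that
the structure map admits an `A`-linear retraction `ρ : B → A`, `ρ 1 = 1` (e.g. `B` free over `A` with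
`1` in a basis). Then for every `n`,
`(algebraMap A B)⁻¹ (caⁿ⁺¹(B)) ⊆ caⁿ⁺¹(A)`, hence `(algebraMap A B)⁻¹ (ca(B)) ⊆ ca(A)`
(`comap_cohomologyAnnihilatorOfDegree_le`, `comap_cohomologyAnnihilator_le`).

Proof. Let `a ∈ A` with `c := algebraMap a ∈ caⁿ⁺¹(B)`, `M`, `N` finitely generated `A`-modules,
`i ≥ n + 1`. (1) `M` is a retract of `(B ⊗_A M)|_A` (tree `exists_retract_restrictScalars_baseChange`),
so it suffices to kill `Extⁱ_A(X|_A, N)` for finitely generated `B`-modules `X`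
(`smul_ext_restrictScalars_eq_zero`). (2) Take `K = Ωⁿ_B X` and a presentation
`0 → K₁ → Bᵐ → K → 0`; `c` kills `Ext¹_B(K, K₁) ≅↪ Extⁿ⁺¹_B(X, K₁)` (injective dimension shifting,
tree `ext_smul_eq_zero_of_isSyzygy`), so `c • 𝟙_K` lifts along `Bᵐ ↠ K` (splitting criterion, tree
`exists_comp_eq_smul_id_X₃_of_smul_extClass_eq_zero`). (3) Restricting scalars, `a • 𝟙_{K|_A}` factors
through `Bᵐ|_A`, whose higher `Ext`'s over `A` vanish (`Bᵐ|_A` is a retract of a power of `B|_A ≅ B`,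
projective over `A`: `ext_restrictScalars_self_eq_zero`, `ext_restrictScalars_eq_zero_of_projective`);
hence `a` kills `Ext^{≥1}_A(K|_A, N)` (`smul_ext_restrictScalars_eq_zero_of_isSyzygy`). (4) Climb back
along the restricted syzygy sequences (exact; the connecting maps are onto because the middle terms have
vanishing higher `Ext` over `A`): `a` kills `Ext^{≥ n+1}_A(X|_A, N)` (`smul_ext_restrictScalars_aux`). ∎

**Use (report §10.1 (S3)).** For `B = A[z]` (a cylinder) localised at `(𝔫, z)`, the substitution
`z ↦ zⁿ` is such an extension (`A[z]_{(𝔫,z)}` is free of rank `n` over `A[zⁿ]_{(𝔫,zⁿ)}` with basis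
`1, z, …, zⁿ⁻¹`), so `g(zⁿ) ∈ ca ⟹ g(z) ∈ ca`; with `𝔞_j := {a : a zʲ ∈ ca}` this gives
`𝔞_{nj} ⊆ 𝔞_j`, whence `𝔞_j = 𝔞_1` for all `j ≥ 1` and closed-point locality of `ca` on a cylinder
over an isolated singularity is equivalent to the single implication `a z ∈ ca ⟹ a ∈ ca`.

## References
* S. B. Iyengar, R. Takahashi, *Annihilation of cohomology and strong generation of module categories*,
  IMRN 2016 (arXiv:1404.1476), §2 (Remark 2.3, Lemma 2.14), proof of Thm. 5.4. [IyengarTakahashi2014]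
-/

set_option linter.dupNamespace false
set_option autoImplicit false

noncomputable section

open CategoryTheory CategoryTheory.Abelian CategoryTheory.Limits
open Literature.RingTheory.CohomologyAnnihilator
open scoped TensorProduct

universe u

namespace Summit.ResolutionOfSingularities.ResolutionOfSingularities.Theorems.K51CaPullback

variable {A B : Type u} [CommRing A] [CommRing B] [Algebra A B]

/-- **`B|_A` has no higher `Ext` over `A` when `B` is `A`-projective.** The restriction of scalars of
the `B`-module `B` is (the identity map, `A`-linear by `Algebra.smul_def`) a retract of the `A`-module
`B`, which is projective; so `Extʲ⁺¹_A(B|_A, N) = 0`. [OURS · L1 W5.1; folklore] -/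
theorem ext_restrictScalars_self_eq_zero [Module.Projective A B] (N : ModuleCat.{u} A) {j : ℕ}
    (e : Ext.{u} ((restrictScalarsFunctor A B).obj (ModuleCat.of B B)) N (j + 1)) : e = 0 := by
  let i : (restrictScalarsFunctor A B).obj (ModuleCat.of B B) ⟶ ModuleCat.of A B :=
    ModuleCat.ofHom (X := (restrictScalarsFunctor A B).obj (ModuleCat.of B B))
      { toFun := fun b => b
        map_add' := fun _ _ => rfl
        map_smul' := fun a b => by
          have h := Algebra.smul_def a (show B from b)
          exact h.symm }
  let p : ModuleCat.of A B ⟶ (restrictScalarsFunctor A B).obj (ModuleCat.of B B) :=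
    ModuleCat.ofHom (Y := (restrictScalarsFunctor A B).obj (ModuleCat.of B B))
      { toFun := fun b => b
        map_add' := fun _ _ => rfl
        map_smul' := fun a b => Algebra.smul_def a b }
  have hip : i ≫ p = 𝟙 _ := by
    apply ModuleCat.hom_ext
    exact LinearMap.ext fun _ => rfl
  have key := ext_smul_eq_zero_of_retract i p hip (1 : A)
    (fun e' => by rw [Ext.eq_zero_of_projective e', smul_zero]) e
  rwa [one_smul] at key

/-- **Restrictions of finitely generated projective `B`-modules have no higher `Ext` over `A`** (`B`
projective over `A`): such a `P` is a direct summand of some `Bᵐ` over `B`, hence `P|_A` is a retract of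
`(B|_A)ᵐ` (tree `IsRetractOfPower.restrictScalars`), and `Extʲ⁺¹_A(B|_A, N) = 0`.
[OURS · L1 W5.1; folklore] -/
theorem ext_restrictScalars_eq_zero_of_projective [Module.Projective A B] (P : ModuleCat.{u} B)
    [Module.Finite B P] (hP : Projective P) (N : ModuleCat.{u} A) {j : ℕ}
    (e : Ext.{u} ((restrictScalarsFunctor A B).obj P) N (j + 1)) : e = 0 := by
  have hret : IsRetractOfPower (ModuleCat.of B B) P :=
    IsRetractOfPower.of_projective (isRetractOfPower_self _) ‹_› hP
  have key := ext_smul_eq_zero_of_isRetractOfPower (hret.restrictScalars (R := A)) (1 : A)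
    (fun e' => by rw [ext_restrictScalars_self_eq_zero N e', smul_zero]) e
  rwa [one_smul] at key

/-- **Step (2)–(3): killing `Ext^{≥1}_A` of a restricted `n`-th syzygy.** If `algebraMap a ∈ caⁿ⁺¹(B)`
and `K = Ωⁿ_B X` (`X` finitely generated over the noetherian ring `B`, which is finitely generated
projective over `A`), then `a` kills `Extʲ_A(K|_A, N)` for `j ≥ 1` and every `A`-module `N`: the class of
a presentation `0 → K₁ → Bᵐ → K → 0` is killed by `algebraMap a` (injective dimension shifting), so
`(algebraMap a) • 𝟙_K` lifts along `Bᵐ ↠ K`; restricted to `A` this factors `a • 𝟙_{K|_A}` through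
`Bᵐ|_A`, whose higher `Ext`'s vanish. [OURS · L1 W5.1; cf. IyengarTakahashi2014 Rem. 2.3, Lemma 2.14] -/
theorem smul_ext_restrictScalars_eq_zero_of_isSyzygy [IsNoetherianRing B] [Module.Projective A B]
    {a : A} {n : ℕ} (hc : algebraMap A B a ∈ cohomologyAnnihilatorOfDegree B (n + 1))
    {X K : ModuleCat.{u} B} [Module.Finite B X] [Module.Finite B K] (hK : IsSyzygy n X K)
    (N : ModuleCat.{u} A) {j : ℕ} (hj : 1 ≤ j)
    (e : Ext.{u} ((restrictScalarsFunctor A B).obj K) N j) : a • e = 0 := by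
  obtain ⟨m, f, hf⟩ := Module.Finite.exists_fin' B K
  have hS := LinearMap.shortExact_shortComplexKer hf
  haveI : Module.Finite B (LinearMap.ker f) := Module.IsNoetherian.finite B _
  -- the class of the presentation is killed by `algebraMap a`
  have hcls : algebraMap A B a • hS.extClass = 0 := by
    refine ext_smul_eq_zero_of_isSyzygy n hK (ModuleCat.of B (LinearMap.ker f)) 1 le_rfl
      (algebraMap A B a) (fun e' => ?_) hS.extClass
    exact smul_eq_zero_of_mem_cohomologyAnnihilatorOfDegree hc (by omega) e'
  obtain ⟨ψ, hψ⟩ := exists_comp_eq_smul_id_X₃_of_smul_extClass_eq_zero hS hcls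
  -- restricted to `A`: `a • 𝟙` factors through `Bᵐ|_A`
  have hψA : (restrictScalarsFunctor A B).map ψ ≫ (restrictScalarsFunctor A B).map f.shortComplexKer.g =
      a • 𝟙 ((restrictScalarsFunctor A B).obj f.shortComplexKer.X₃) := by
    rw [← Functor.map_comp, hψ]
    apply ModuleCat.hom_ext
    exact LinearMap.ext fun _ => rfl
  have hX₂ : ∀ e₂ : Ext.{u} ((restrictScalarsFunctor A B).obj f.shortComplexKer.X₂) N j, e₂ = 0 := by
    obtain ⟨j', rfl⟩ : ∃ j', j = j' + 1 := ⟨j - 1, by omega⟩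
    intro e₂
    exact ext_restrictScalars_eq_zero_of_projective (ModuleCat.of B (Fin m → B))
      ((IsProjective.iff_projective (R := B) (Fin m → B)).mp inferInstance) N e₂
  have hae : a • e = (Ext.mk₀ ((restrictScalarsFunctor A B).map ψ)).comp
      ((Ext.mk₀ ((restrictScalarsFunctor A B).map f.shortComplexKer.g)).comp e (zero_add j))
        (zero_add j) := by
    rw [Ext.mk₀_comp_mk₀_assoc, hψA, Ext.mk₀_smul, Ext.smul_comp, Ext.mk₀_id_comp]
  have hz := hX₂ ((Ext.mk₀ ((restrictScalarsFunctor A B).map f.shortComplexKer.g)).comp e (zero_add j))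
  rw [hae, hz, Ext.comp_zero]

/-- **Step (4): climbing back along the restricted syzygy sequences.** If `K = Ωˢ_B M` and `a` kills
`Ext^{≥ l}_A(K|_A, −)` (`l ≥ 1`), then `a` kills `Ext^{≥ l+s}_A(M|_A, −)`: the restricted sequences
`0 → Ω^{t+1}M|_A → P|_A → ΩᵗM|_A → 0` are exact and their connecting maps
`Extʲ(Ω^{t+1}M|_A, N) → Extʲ⁺¹(ΩᵗM|_A, N)` are onto for `j ≥ 1`, since `Extʲ⁺¹_A(P|_A, N) = 0`.
[OURS · L1 W5.1; cf. IyengarTakahashi2014 Rem. 2.3] -/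
theorem smul_ext_restrictScalars_aux [Module.Projective A B] (a : A) :
    ∀ (s : ℕ) {M K : ModuleCat.{u} B}, IsSyzygy s M K → ∀ {l : ℕ}, 1 ≤ l →
      (∀ (N : ModuleCat.{u} A) (j : ℕ), l ≤ j →
        ∀ e : Ext.{u} ((restrictScalarsFunctor A B).obj K) N j, a • e = 0) →
      ∀ (N : ModuleCat.{u} A) (j : ℕ), l + s ≤ j →
        ∀ e : Ext.{u} ((restrictScalarsFunctor A B).obj M) N j, a • e = 0 := by
  intro s
  induction s with
  | zero =>
    intro M K hK l _ h N j hj e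
    obtain ⟨ε⟩ := hK
    exact ext_smul_eq_zero_of_iso ((restrictScalarsFunctor A B).mapIso ε) (Iso.refl N) a
      (h N j (by omega)) e
  | succ s ih =>
    intro M K hK l hl h N j hj e
    obtain ⟨K', P, hK', hPfin, hP, f, g, w, hS⟩ := hK
    haveI : Module.Finite B P := hPfin
    -- the restricted sequence `0 → K|_A → P|_A → K'|_A → 0`
    let SA : ShortComplex (ModuleCat.{u} A) :=
      ShortComplex.mk ((restrictScalarsFunctor A B).map f) ((restrictScalarsFunctor A B).map g)
        (by rw [← Functor.map_comp, w, Functor.map_zero])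
    have hSA : SA.ShortExact := hS.map_of_exact (restrictScalarsFunctor A B)
    -- `a` kills `Ext^{≥ l+1}_A(K'|_A, −)`
    have hK'a : ∀ (N : ModuleCat.{u} A) (j : ℕ), l + 1 ≤ j →
        ∀ e : Ext.{u} ((restrictScalarsFunctor A B).obj K') N j, a • e = 0 := by
      intro N' j' hj' e'
      obtain ⟨j₀, rfl⟩ : ∃ j₀, j' = j₀ + 1 := ⟨j' - 1, by omega⟩
      have hzero : (Ext.mk₀ SA.g).comp e' (zero_add (j₀ + 1)) = 0 :=
        ext_restrictScalars_eq_zero_of_projective P hP N' _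
      obtain ⟨x₁, hx₁⟩ := Ext.contravariant_sequence_exact₃ hSA N' e' hzero (add_comm 1 j₀)
      rw [← hx₁, ← Ext.comp_smul, h N' j₀ (by omega) x₁, Ext.comp_zero]
    have := ih hK' (l := l + 1) (by omega) hK'a N j (by omega) e
    exact this

/-- **`a` kills `Ext^{≥ n+1}_A(X|_A, N)` for every finitely generated `B`-module `X`** when
`algebraMap a ∈ caⁿ⁺¹(B)` (`B` noetherian, finitely generated projective over `A`).
[OURS · L1 W5.1] -/
theorem smul_ext_restrictScalars_eq_zero [IsNoetherianRing B] [Module.Projective A B]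
    {a : A} {n : ℕ} (hc : algebraMap A B a ∈ cohomologyAnnihilatorOfDegree B (n + 1))
    (X : ModuleCat.{u} B) [Module.Finite B X] (N : ModuleCat.{u} A) {i : ℕ} (hi : n + 1 ≤ i)
    (e : Ext.{u} ((restrictScalarsFunctor A B).obj X) N i) : a • e = 0 := by
  obtain ⟨K, hKfin, hK⟩ := exists_isSyzygy X n
  haveI := hKfin
  exact smul_ext_restrictScalars_aux a n hK (l := 1) le_rfl
    (fun N' j hj e' => smul_ext_restrictScalars_eq_zero_of_isSyzygy hc hK N' hj e') N i
    (by omega) e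

/-- **Pull-back of `caⁿ⁺¹` along a split finite projective extension (report §10.1 (S3)).** If `B` is a
noetherian commutative `A`-algebra, finitely generated and projective as an `A`-module, and the structure
map has an `A`-linear retraction `ρ` with `ρ 1 = 1`, then `(algebraMap A B)⁻¹(caⁿ⁺¹(B)) ⊆ caⁿ⁺¹(A)`:
a finitely generated `A`-module `M` is a retract of `(B ⊗_A M)|_A`
(tree `exists_retract_restrictScalars_baseChange`), and `a` kills `Ext^{≥ n+1}_A((B ⊗_A M)|_A, N)` by
`smul_ext_restrictScalars_eq_zero`. [OURS · L1 W5.1] -/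
theorem comap_cohomologyAnnihilatorOfDegree_le [IsNoetherianRing B] [Module.Projective A B]
    (ρ : B →ₗ[A] A) (hρ : ρ 1 = 1) (n : ℕ) :
    (cohomologyAnnihilatorOfDegree B (n + 1)).comap (algebraMap A B) ≤
      cohomologyAnnihilatorOfDegree A (n + 1) := by
  intro a ha
  rw [Ideal.mem_comap] at ha
  rw [mem_cohomologyAnnihilatorOfDegree_iff]
  intro i hi M N hM hN e
  obtain ⟨ι, p, hιp⟩ := exists_retract_restrictScalars_baseChange A B ρ hρ M
  exact ext_smul_eq_zero_of_retract ι p hιp a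
    (fun e' => smul_ext_restrictScalars_eq_zero ha (ModuleCat.of B (B ⊗[A] M)) N hi e') e

/-- **Pull-back of the full cohomology annihilator** under the same hypotheses:
`(algebraMap A B)⁻¹(ca(B)) ⊆ ca(A)`. Applied to `z ↦ zⁿ` on a localised cylinder `A[z]_{(𝔫,z)}`
(free of rank `n` over its image, basis `1, …, zⁿ⁻¹`) it gives `g(zⁿ) ∈ ca ⟹ g(z) ∈ ca`, the
reduction (S3) of the report: closed-point locality of `ca` on a cylinder is the single implication
`a·z ∈ ca ⟹ a ∈ ca`. [OURS · L1 W5.1] -/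
theorem comap_cohomologyAnnihilator_le [IsNoetherianRing B] [Module.Projective A B]
    (ρ : B →ₗ[A] A) (hρ : ρ 1 = 1) :
    (cohomologyAnnihilator B).comap (algebraMap A B) ≤ cohomologyAnnihilator A := by
  intro a ha
  rw [Ideal.mem_comap, mem_cohomologyAnnihilator_iff] at ha
  obtain ⟨m, hm⟩ := ha
  have hm' : algebraMap A B a ∈ cohomologyAnnihilatorOfDegree B (m + 1) :=
    cohomologyAnnihilatorOfDegree_mono (Nat.le_succ m) hm
  exact cohomologyAnnihilatorOfDegree_le (m + 1)
    (comap_cohomologyAnnihilatorOfDegree_le ρ hρ m (Ideal.mem_comap.mpr hm'))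

end Summit.ResolutionOfSingularities.ResolutionOfSingularities.Theorems.K51CaPullback

end
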